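/-
Copyright (c) 2026 the pub-hodgecm-mathlib formalisation cell (harness21).  Prover seat hodgecm-mathlib-LH4-p08 (g9), req620 Track A «(D-RAM) FOUR-FRAME» squad, helper lane
on h413 = stmt-HodgeConjecture-24833 (count-neutral).  STAGE-1b, row (2), RamM lane of the (LAW) END — (R5a), the regime-B (window-parity) cut identity.  2026-09-04.
-/
import Summits.HodgeConjecture.HodgeConjecture.Theorems.F0P3cDyRamToricCensusSumRamMV2       -- ★ (LH4-p04 (g5)): T5s EDITION 2 `toricCensusSum_ramM_v2` (parity OR window; near cells agree)
import Summits.HodgeConjecture.HodgeConjecture.Theorems.F0P3cDyRamToricCensusSumRamMCutoff   -- ★ p859810 (LH4-p04 (g7)): `sum_cut_part_eq_ramM` (the cut band, parity-free)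
import HarnessLib

/-!
# Crux `H413`, line LH4 «(D-RAM) FOUR-FRAME» — STAGE-1b, row (2): (T5-P-coneΔ-R2)-RamM **v2** «THE CUT WELD WITH AN ALIVE OFFSET UNDER THE WINDOW-PARITY LETTER»
# ★ `toricCensusSum_ramM_cut_offset`'s conclusion VERBATIM from T5s v2's binders (`m ≡ d_E ∨ jl + 2 ≤ m + 2g + s0`; near top cells only AGREE; far cells explicit with offset)

Cell `hodgecm-mathlib` (D-0151), FLOOR 0, crux item H413 = `stmt-HodgeConjecture-24833`, route of record `HCCMUnconditional`; squad F0∕P3c∕LH4 (req618∕req620); helper lane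
`--supports stmt-HodgeConjecture-24833 --as helper` (count-neutral).  ONE THEOREM (no `def`, no instance, no notation, no `sorry`; default heartbeats); finite-sum bookkeeping
over `ℚ` on ABSTRACT tables.

WHY (the (R5?) question of this seat, 2026-09-04T13:42Z).  ★ `toricCensusSum_ramM_cut[_offset]` (LH4-p04 (g7)) is built on T5s EDITION 1 and carries the strict parity
letter `hpar : m % 2 = (g + s0) % 2`; ★ p859973 `…flip_cut[_offset]` carries `m % 2 = (g + s0 + 1) % 2` with `jl % 2 = (g + 1) % 2` — both force `m − jl ≡ s0 (2)`, the
REGIME-A parity.  But the RamM tokens near `1` realise BOTH regimes (★ (C) `orderCountCensusC` :295: `hreg : (m + s0 ≤ jl ∧ (m + s0) % 2 = jl % 2) ∨ jl + 1 = m + s0`), which is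
why the uncut weld ★ `toricCensusSum_ramM_weld` rests on T5s EDITION 2 ★ `toricCensusSum_ramM_v2` with the relaxed letter `hparW : m % 2 = (g + s0) % 2 ∨ jl + 2 ≤ m + 2g + s0`
and near top cells only asked to AGREE.  THIS FILE is the cut twin of EDITION 2 — so the regime-B rows of the level pieces with EVEN schedule `a′` have a cut identity:
* **`toricCensusSum_ramM_v2_cut_offset`** — ★ `toricCensusSum_ramM_v2`'s binders VERBATIM through `hvOff`, then `hvTopNear` VERBATIM (agreement), `(e : ℕ)` and
  `hvTopFarE` (v2's `hvTopFar` with the alive condition shifted to `2j + (g+s0) ≤ 2jl + 1 + e` — the cells of a SCALED multiplier, ★ p859832's observation), the cutoff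
  `(C) (hC : jl ≤ C) (hCe : C + (g + s0) ≤ m + jl + 1)` ⊢ ★ `toricCensusSum_ramM_cut_offset`'s conclusion VERBATIM.
PROOF (no new identity): re-table the top diagonal in EDITION 1's explicit shape at the STANDARD alive boundary (`w′`): (i) the cut sums of `v` and `w′` agree CELL BY CELL —
near cut cells contribute `0` to both (agreement ∕ equal explicit values), far cut cells are standard-alive by `hCe` and carry the same far value, cells beyond the standard
boundary are cut; (ii) `cut(w′) = full(w′) − band(w′)` (★ p859810's split); (iii) `full(w′)` = ★ v2 (its `hvTopNear`∕`hvTopFar` hold for `w′` by construction); (iv) `band(w′)` =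
★ `sum_cut_part_eq_ramM` (`w′` has EDITION 1's `hvTop`).
HONEST LABEL.  Count-neutral; nothing about the census is asserted (tables are hypotheses); `HC_CM` is proved only modulo the 7 printed citations (2 remaining named inputs: hLiu418 =
`stmt-HodgeConjecture-24832`, h413 = `stmt-HodgeConjecture-24833`) until rung 0 closes.

## References
* [Kottwitz1986BaseChangeUnits] R. E. Kottwitz, *Base change for unit elements of Hecke algebras*, Compositio Math. 60 (1986): §1 pp. 240–241.
* [Rogawski1990] J. D. Rogawski, *Automorphic Representations of Unitary Groups in Three Variables*, Ann. of Math. Stud. 123 (1990): §4.9 Prop. 4.9.1 (b) p. 55, Lemma 4.9.3 p. 56.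
* [Flicker1998UnitaryFL] Y. Z. Flicker, *Elementary proof of the fundamental lemma for a unitary group*, Canad. J. Math. 50 (1998): Prop. 7 p. 84 (the level tables).
-/

set_option autoImplicit false

namespace Summit.HodgeConjecture.HodgeConjecture.Cruxes.H413.F0P3cDyRamToricCensusSumRamMV2CutOffset

open Finset
open Summit.HodgeConjecture.HodgeConjecture.Cruxes.H413.F0P3cDyRamToricCensusSumRamMV2 (toricCensusSum_ramM_v2)
open Summit.HodgeConjecture.HodgeConjecture.Cruxes.H413.F0P3cDyRamToricCensusSumRamMCutoff (sum_cut_part_eq_ramM)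

/-- **(T5-P-coneΔ-R2)-RamM v2 — THE CUT WELD WITH AN ALIVE OFFSET UNDER THE WINDOW-PARITY LETTER.**  T5s EDITION 2's binders (`hparW`; near top cells AGREE; far top cells
explicit, here with the alive offset `e`), a cutoff `jl ≤ C` with `C + d_E ≤ m + jl + 1` ⊢ ★ `toricCensusSum_ramM_cut_offset`'s conclusion VERBATIM — both parity regimes.
[cite: Kottwitz1986BaseChangeUnits, §1 pp. 240–241] [cite: Rogawski1990, §4.9 Prop. 4.9.1 (b) p. 55, Lemma 4.9.3 p. 56] [cite: Flicker1998UnitaryFL, Prop. 7 p. 84] -/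
theorem toricCensusSum_ramM_v2_cut_offset (q : ℕ) {g s0 jl m : ℕ} (ε : ℚ) (hq : 2 ≤ q) (hg : 1 ≤ g) (hs0 : 1 ≤ s0) (hjl : jl % 2 = g % 2)
    (hjlS : 3 * g + 2 * s0 ≤ jl + 2 + 2 * ((g + s0) % 2)) (hparW : m % 2 = (g + s0) % 2 ∨ jl + 2 ≤ m + 2 * g + s0) (hmS : g + s0 - (g + s0) % 2 ≤ m + 1) (hm : m ≤ jl)
    (hε : ε = 1 ∨ (ε = -1 ∧ jl + 2 ≤ m + 2 * g + s0))
    (nP nM vP vM : ℕ → ℕ → ℚ)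
    (hnP : ∀ j a, nP j a = ((if j = 0 then (if a = 0 then 1 else 0) else if j < a then 0
      else if j - a + 1 = s0 then q ^ j else if j - a + 1 < s0 then (if a = 0 then q ^ j else 0) else if (j - a - s0) % 2 = 1 then 0
      else if a = 0 then (if 2 * g ≤ j - a - s0 then 2 else 1) * q ^ (j - (j - a - s0) / 2)
      else if j - a - s0 + 2 < 2 * g then (q - 1) * q ^ (j - 1 - (j - a - s0) / 2) else if j - a - s0 + 2 = 2 * g then (q - 2) * q ^ (j - 1 - (j - a - s0) / 2)
      else 2 * (q - 1) * q ^ (j - 1 - (j - a - s0) / 2) : ℕ) : ℚ))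
    (hnM : ∀ j a, nM j a = ((if j = 0 then (if a = 0 then 1 else 0) else if j < a then 0
      else if j - a + 1 = s0 then q ^ j else if j - a + 1 < s0 then (if a = 0 then q ^ j else 0) else if (j - a - s0) % 2 = 1 then 0
      else if a = 0 then (if j - a - s0 + 2 ≤ 2 * g then q ^ (j - (j - a - s0) / 2) else 0)
      else if j - a - s0 + 2 < 2 * g then (q - 1) * q ^ (j - 1 - (j - a - s0) / 2) else if j - a - s0 + 2 = 2 * g then q ^ (j - (j - a - s0) / 2) else 0 : ℕ) : ℚ))
    (hvGen : ∀ j a, (a ≤ m ∧ (j + a ≤ m ∨ (2 * a ≤ m ∧ j + a ≤ jl))) → vP j a = nP j a ∧ vM j a = nM j a)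
    (hvOff : ∀ j a, ¬ (a ≤ m ∧ (j + a ≤ m ∨ (2 * a ≤ m ∧ j + a ≤ jl))) → j + m ≠ jl + a → vP j a = 0 ∧ vM j a = 0)
    (hvTopNear : ∀ j a, ¬ (a ≤ m ∧ (j + a ≤ m ∨ (2 * a ≤ m ∧ j + a ≤ jl))) → j + m = jl + a → j + a + 2 ≤ m + s0 + 2 * g → vP j a = vM j a)
    (e : ℕ)
    (hvTopFarE : ∀ j a, ¬ (a ≤ m ∧ (j + a ≤ m ∨ (2 * a ≤ m ∧ j + a ≤ jl))) → j + m = jl + a → ¬ (j + a + 2 ≤ m + s0 + 2 * g) →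
      (vP j a = if 2 * j + (g + s0) ≤ 2 * jl + 1 + e ∧ ε = 1 then 2 * (q : ℚ) ^ (j - (j + a - m - s0 + 1) / 2) else 0) ∧
      (vM j a = if 2 * j + (g + s0) ≤ 2 * jl + 1 + e ∧ ε = -1 then 2 * (q : ℚ) ^ (j - (j + a - m - s0 + 1) / 2) else 0))
    (C : ℕ) (hC : jl ≤ C) (hCe : C + (g + s0) ≤ m + jl + 1) :
    ε * ∑ j ∈ range (jl + 1), ∑ a ∈ range (jl + 2), (q : ℚ) ^ a * (if j + a ≤ C then vP j a - vM j a else 0) =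
      (q : ℚ) ^ m * (2 * ∑ i ∈ range ((jl - g) / 2 + 1), (q : ℚ) ^ i - 2 * ∑ i ∈ range (g + s0 - (g + s0) % 2), (q : ℚ) ^ i) -
        2 * ∑ a ∈ (range (jl + 2)).filter (fun a => a ≤ m ∧ C + m < jl + 2 * a ∧ 2 * m + 2 * g + s0 < jl + 2 * a + 2 ∧ 2 * a + (g + s0) ≤ 2 * m + 1),
          (q : ℚ) ^ (a + (jl + s0) / 2) := by
  classical
  have hε' : ε = 1 ∨ ε = -1 := hε.imp_right And.left
  -- (0) the EDITION-1 re-tabling of the top diagonal at the STANDARD alive boundary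
  obtain ⟨wP, hwPdef⟩ : ∃ f : ℕ → ℕ → ℚ, f = fun j a =>
      if ¬ (a ≤ m ∧ (j + a ≤ m ∨ (2 * a ≤ m ∧ j + a ≤ jl))) ∧ j + m = jl + a then
        (if 2 * j + (g + s0) ≤ 2 * jl + 1 ∧ (j + a + 2 ≤ m + s0 + 2 * g ∨ ε = 1) then
          (if j + a < m + s0 then (q : ℚ) ^ j else (if 2 * g ≤ j + a - m - s0 + 1 then 2 else 1) * (q : ℚ) ^ (j - (j + a - m - s0 + 1) / 2)) else 0)
      else vP j a := ⟨_, rfl⟩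
  obtain ⟨wM, hwMdef⟩ : ∃ f : ℕ → ℕ → ℚ, f = fun j a =>
      if ¬ (a ≤ m ∧ (j + a ≤ m ∨ (2 * a ≤ m ∧ j + a ≤ jl))) ∧ j + m = jl + a then
        (if 2 * j + (g + s0) ≤ 2 * jl + 1 ∧ (j + a + 2 ≤ m + s0 + 2 * g ∨ ε = -1) then
          (if j + a < m + s0 then (q : ℚ) ^ j else (if 2 * g ≤ j + a - m - s0 + 1 then 2 else 1) * (q : ℚ) ^ (j - (j + a - m - s0 + 1) / 2)) else 0)
      else vM j a := ⟨_, rfl⟩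
  have hwGen : ∀ j a, (a ≤ m ∧ (j + a ≤ m ∨ (2 * a ≤ m ∧ j + a ≤ jl))) → wP j a = nP j a ∧ wM j a = nM j a := fun j a hG => by
    obtain ⟨h1, h2⟩ := hvGen j a hG
    have hnt : ¬ (¬ (a ≤ m ∧ (j + a ≤ m ∨ (2 * a ≤ m ∧ j + a ≤ jl))) ∧ j + m = jl + a) := fun h0 => h0.1 hG
    rw [hwPdef, hwMdef]; dsimp only; rw [if_neg hnt, if_neg hnt, h1, h2]; exact ⟨rfl, rfl⟩
  have hwOff : ∀ j a, ¬ (a ≤ m ∧ (j + a ≤ m ∨ (2 * a ≤ m ∧ j + a ≤ jl))) → j + m ≠ jl + a → wP j a = 0 ∧ wM j a = 0 := fun j a hnG hoff => by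
    obtain ⟨h1, h2⟩ := hvOff j a hnG hoff
    have hnt : ¬ (¬ (a ≤ m ∧ (j + a ≤ m ∨ (2 * a ≤ m ∧ j + a ≤ jl))) ∧ j + m = jl + a) := fun h0 => hoff h0.2
    rw [hwPdef, hwMdef]; dsimp only; rw [if_neg hnt, if_neg hnt, h1, h2]; exact ⟨rfl, rfl⟩
  -- EDITION 1's `hvTop` for `w′` (by construction)
  have hwTop : ∀ j a, ¬ (a ≤ m ∧ (j + a ≤ m ∨ (2 * a ≤ m ∧ j + a ≤ jl))) → j + m = jl + a →
      (wP j a = if 2 * j + (g + s0) ≤ 2 * jl + 1 ∧ (j + a + 2 ≤ m + s0 + 2 * g ∨ ε = 1) then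
          (if j + a < m + s0 then (q : ℚ) ^ j else (if 2 * g ≤ j + a - m - s0 + 1 then 2 else 1) * (q : ℚ) ^ (j - (j + a - m - s0 + 1) / 2)) else 0) ∧
      (wM j a = if 2 * j + (g + s0) ≤ 2 * jl + 1 ∧ (j + a + 2 ≤ m + s0 + 2 * g ∨ ε = -1) then
          (if j + a < m + s0 then (q : ℚ) ^ j else (if 2 * g ≤ j + a - m - s0 + 1 then 2 else 1) * (q : ℚ) ^ (j - (j + a - m - s0 + 1) / 2)) else 0) :=
    fun j a hnG hdiag => by
    have hnt : ¬ (a ≤ m ∧ (j + a ≤ m ∨ (2 * a ≤ m ∧ j + a ≤ jl))) ∧ j + m = jl + a := ⟨hnG, hdiag⟩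
    rw [hwPdef, hwMdef]; dsimp only; rw [if_pos hnt, if_pos hnt]; exact ⟨rfl, rfl⟩
  -- EDITION 2's `hvTopNear` ∕ `hvTopFar` for `w′`
  have hwTopNear : ∀ j a, ¬ (a ≤ m ∧ (j + a ≤ m ∨ (2 * a ≤ m ∧ j + a ≤ jl))) → j + m = jl + a → j + a + 2 ≤ m + s0 + 2 * g → wP j a = wM j a :=
    fun j a hnG hdiag hnear => by
    obtain ⟨hP, hM⟩ := hwTop j a hnG hdiag
    have hiffP : (2 * j + (g + s0) ≤ 2 * jl + 1 ∧ (j + a + 2 ≤ m + s0 + 2 * g ∨ ε = 1)) ↔ 2 * j + (g + s0) ≤ 2 * jl + 1 :=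
      ⟨fun h0 => h0.1, fun h0 => ⟨h0, Or.inl hnear⟩⟩
    have hiffM : (2 * j + (g + s0) ≤ 2 * jl + 1 ∧ (j + a + 2 ≤ m + s0 + 2 * g ∨ ε = -1)) ↔ 2 * j + (g + s0) ≤ 2 * jl + 1 :=
      ⟨fun h0 => h0.1, fun h0 => ⟨h0, Or.inl hnear⟩⟩
    rw [hP, hM, if_congr hiffP rfl rfl, if_congr hiffM rfl rfl]
  have hwTopFar : ∀ j a, ¬ (a ≤ m ∧ (j + a ≤ m ∨ (2 * a ≤ m ∧ j + a ≤ jl))) → j + m = jl + a → ¬ (j + a + 2 ≤ m + s0 + 2 * g) →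
      (wP j a = if 2 * j + (g + s0) ≤ 2 * jl + 1 ∧ ε = 1 then 2 * (q : ℚ) ^ (j - (j + a - m - s0 + 1) / 2) else 0) ∧
      (wM j a = if 2 * j + (g + s0) ≤ 2 * jl + 1 ∧ ε = -1 then 2 * (q : ℚ) ^ (j - (j + a - m - s0 + 1) / 2) else 0) := fun j a hnG hdiag hfar => by
    obtain ⟨hP, hM⟩ := hwTop j a hnG hdiag
    have hlt : ¬ (j + a < m + s0) := by omega
    have h2g : 2 * g ≤ j + a - m - s0 + 1 := by omega
    rw [hP, hM, if_neg hlt, if_pos h2g]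
    constructor
    · by_cases hc : 2 * j + (g + s0) ≤ 2 * jl + 1 ∧ ε = 1
      · have hc' : 2 * j + (g + s0) ≤ 2 * jl + 1 ∧ (j + a + 2 ≤ m + s0 + 2 * g ∨ ε = 1) := ⟨hc.1, Or.inr hc.2⟩
        rw [if_pos hc, if_pos hc']
      · have hc' : ¬ (2 * j + (g + s0) ≤ 2 * jl + 1 ∧ (j + a + 2 ≤ m + s0 + 2 * g ∨ ε = 1)) := fun h0 => hc ⟨h0.1, h0.2.resolve_left hfar⟩
        rw [if_neg hc, if_neg hc']
    · by_cases hc : 2 * j + (g + s0) ≤ 2 * jl + 1 ∧ ε = -1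
      · have hc' : 2 * j + (g + s0) ≤ 2 * jl + 1 ∧ (j + a + 2 ≤ m + s0 + 2 * g ∨ ε = -1) := ⟨hc.1, Or.inr hc.2⟩
        rw [if_pos hc, if_pos hc']
      · have hc' : ¬ (2 * j + (g + s0) ≤ 2 * jl + 1 ∧ (j + a + 2 ≤ m + s0 + 2 * g ∨ ε = -1)) := fun h0 => hc ⟨h0.1, h0.2.resolve_left hfar⟩
        rw [if_neg hc, if_neg hc']
  -- (i) the cut sums of `v` and `w′` agree cell by cell
  have hcell : ∀ j a, (if j + a ≤ C then vP j a - vM j a else 0) = (if j + a ≤ C then wP j a - wM j a else 0) := fun j a => by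
    by_cases hcut : j + a ≤ C
    · rw [if_pos hcut, if_pos hcut]
      by_cases hnt : ¬ (a ≤ m ∧ (j + a ≤ m ∨ (2 * a ≤ m ∧ j + a ≤ jl))) ∧ j + m = jl + a
      · have halive : 2 * j + (g + s0) ≤ 2 * jl + 1 := by omega
        by_cases hnear : j + a + 2 ≤ m + s0 + 2 * g
        · rw [hvTopNear j a hnt.1 hnt.2 hnear, sub_self, hwTopNear j a hnt.1 hnt.2 hnear, sub_self]
        · obtain ⟨hP, hM⟩ := hvTopFarE j a hnt.1 hnt.2 hnear
          obtain ⟨hP', hM'⟩ := hwTopFar j a hnt.1 hnt.2 hnear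
          have hiffP : (2 * j + (g + s0) ≤ 2 * jl + 1 + e ∧ ε = 1) ↔ (2 * j + (g + s0) ≤ 2 * jl + 1 ∧ ε = 1) :=
            ⟨fun h0 => ⟨halive, h0.2⟩, fun h0 => ⟨by omega, h0.2⟩⟩
          have hiffM : (2 * j + (g + s0) ≤ 2 * jl + 1 + e ∧ ε = -1) ↔ (2 * j + (g + s0) ≤ 2 * jl + 1 ∧ ε = -1) :=
            ⟨fun h0 => ⟨halive, h0.2⟩, fun h0 => ⟨by omega, h0.2⟩⟩
          rw [hP, hM, hP', hM', if_congr hiffP rfl rfl, if_congr hiffM rfl rfl]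
      · rw [hwPdef, hwMdef]; dsimp only; rw [if_neg hnt, if_neg hnt]
    · rw [if_neg hcut, if_neg hcut]
  simp_rw [hcell]
  -- (ii) cut(w′) = full(w′) − band(w′); (iii) ★ v2; (iv) ★ the cut band
  have hsplit : ∀ j a, (q : ℚ) ^ a * (if j + a ≤ C then wP j a - wM j a else 0) =
      (q : ℚ) ^ a * (wP j a - wM j a) - (q : ℚ) ^ a * (if C < j + a then wP j a - wM j a else 0) := fun j a => by
    by_cases h : j + a ≤ C
    · rw [if_pos h, if_neg (not_lt.2 h), mul_zero, sub_zero]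
    · rw [if_neg h, if_pos (not_le.1 h), mul_zero, sub_self]
  simp_rw [hsplit]
  simp only [Finset.sum_sub_distrib]
  rw [mul_sub, toricCensusSum_ramM_v2 q ε hq hg hs0 hjl hjlS hparW hmS hm hε nP nM wP wM hnP hnM hwGen hwOff hwTopNear hwTopFar,
    sum_cut_part_eq_ramM (q : ℚ) ε hε' hg hm hC wP wM hwOff hwTop]

end Summit.HodgeConjecture.HodgeConjecture.Cruxes.H413.F0P3cDyRamToricCensusSumRamMV2CutOffset
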